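import Literature.AlgebraicGeometry.ModuliOfAbelianVarieties.SiegelCMTorsionCongruence
import HarnessLib

/-!
# The rational lattice determines the adelic lattice: `q_v⁻¹Λ_a = ∏ 𝔞ᵢ ⇒ Θ_v⁻¹(a·ẑ^{2g}) = ∏ 𝔞̂ᵢ`, modulo boundedness of `Θ_v`
# ([Shimura 1998] §18.3 «`M/𝔞 ≅ ⊕ M_p/𝔞_p`», (18.3a); [Milne 2005] §4 «`V/Λ ≅ V(𝔸_f)/Λ̂`», Def. 12.8; [Deligne 1971] 4.18–4.20)

Topic `AlgebraicGeometry/ModuliOfAbelianVarieties`; namespace `Literature.AlgebraicGeometry.ModuliOfAbelianVarieties.CMStructure`.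
Cell hodgecm-mathlib (D-0151), #60 road (row I-7 `SiegelS1`), leaf R60-35b (lead A-p05; the CONVERSE of ★ R60-35
`SiegelCMLatticeReciprocity`, MUMFORD-LINE-SPEC §3 step 5).  THEOREMS ONLY: no definition, no named fact, no instance, no `sorry`
(net Literature debt 0).  A banked GENERIC leaf (director s86 (2)(b)); HC_CM is proved only modulo the printed citations until
rung 0 closes.

## What is proved

★ R60-35 describes the lattice of the translated point `[J, r·a]` under the ADELIC hypothesis `ha`: «the adelic lattice `a·ẑ^{2g}`
pulled back along the orbit map `Θ_v : u ↦ R(u)·(v ⊗ 1)` is `∏ᵢ 𝔞̂ᵢ`».  The moduli reading of a point `[J, a]` (the cell's T1′) hands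
over the RATIONAL lattice only: `q_v⁻¹(Λ_a) = ∏ᵢ 𝔞ᵢ`, i.e. `act(x)·v ∈ Λ_a ↔ xᵢ ∈ 𝔞ᵢ` for `x ∈ F`.  Here the rational description is
shown to IMPLY the adelic one (`forall_inv_mulVec_mem_iff_of_rational`), by the weak form of strong approximation
`𝔸_{K,f} = K + 𝔟̂` (★ `IdeleAction.exists_sub_algebraMap_mem_idealAdeles`) applied with a modulus `𝔟ᵢ = M·Dᵢ·𝔞ᵢ` small enough that
both `a⁻¹` (★ R60-19 `exists_nat_mul_entries_mem`) and `Θ_v` have cleared denominators on `𝔟̂` — GRANTED ONE NAMED INPUT, the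
boundedness of the orbit map on integral adèles:

  `hbdd : ∃ N ≠ 0, ∀ u ∈ ∏ᵢ 𝓞̂ᵢ, N · Θ_v(u) ∈ ẑ^{2g}`

(true: the coordinates of an integral adèle in an integral basis are integral — the global form of ★ FLT-port
`adicCompletion.integerBaseChangeLinearEquiv_bijOn`, `𝓞_K ⊗ ℤ_p ≅ ∏_{w∣p} 𝒪_w`; not yet a tree statement about
★ `ratFiniteAdeleTensorEquiv`, so it is carried as a hypothesis and NOT restated as a fact).  Corollaries: the hypotheses of ★ R60-35 /
★ R60-43 are met from the rational reading, so «the lattice of `[J, r·a]` is `∏ tᵢ𝔞ᵢ`» (`act_mem_latticeOfGL_mul_iff_of_rational`).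

## References
* [Shimura1998] G. Shimura, *Abelian Varieties with Complex Multiplication and Modular Functions* (1998), §18.3 pp. 122–123.
* [Milne2005ShimuraVarieties] J. S. Milne, *Introduction to Shimura varieties* (2005), §4 pp. 48–49; Def. 12.8 (60)–(62) p. 114.
* [Deligne1971TravauxShimura] P. Deligne, *Travaux de Shimura*, Sém. Bourbaki 389 (1971), 4.18–4.20 pp. 150–152.
* [CasselsFrohlichANT1967] J. W. S. Cassels, A. Fröhlich (eds.), *Algebraic Number Theory* (1967), Ch. II §14–§15 (strong approximation).
-/

set_option autoImplicit false

noncomputable section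

open Module Function NumberField Matrix IsDedekindDomain
open scoped TensorProduct nonZeroDivisors

namespace Literature.AlgebraicGeometry.ModuliOfAbelianVarieties

namespace CMStructure

open Literature.AlgebraicGeometry.Motives (CMType)
open Literature.NumberTheory.ComplexMultiplication
  (traceField ratFiniteAdeleTensorEquiv reflexNormFiniteIdele ratFiniteAdeleTensorEquiv_tmul)
open Literature.NumberTheory.Automorphic (integralFiniteAdeles)
open Literature.NumberTheory.Automorphic.FiniteAdeleRing (toFractionalIdeal)
open Literature.NumberTheory.Adeles (latticeOfGL mem_latticeOfGL_iff exists_nat_mul_entries_mem)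
open Literature.NumberTheory.NumberFields.IdeleAction
  (idealAdeles ideleMulIdeal ideleMulIdeal_ne_zero mul_mem_idealAdeles_iff algebraMap_mem_idealAdeles_iff idealAdeles_mono
    exists_sub_algebraMap_mem_idealAdeles toFractionalIdeal_unitEmbedding)

variable {g : ℕ} {δ : Fin g → ℕ} {ι : Type} [Fintype ι] [DecidableEq ι] {K : ι → Type} [∀ i, Field (K i)]
  [∀ i, NumberField (K i)] [∀ i, IsCMField (K i)] (c : CMStructure g δ ι K)

/-! ### §1. Scalars `N ∈ ℕ` move through the orbit map -/

/-- **`R(N·u)·w = N · R(u)·w`** for a natural number `N` acting diagonally on `∏ᵢ 𝔸_{Kᵢ,f}` (★ `cmRepMatrix_baseChange_scalar`: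
scalars of `𝔸_{ℚ,f}` act by scalars). [cite: Deligne1971TravauxShimura, 3.9 p. 140] -/
theorem cmRepMatrix_natCast_mul_mulVec (N : ℕ) (u : Π i, FiniteAdeleRing (𝓞 (K i)) (K i))
    (w : Fin g ⊕ Fin g → finAdeleQ) :
    c.cmRepMatrix (fun i => (N : FiniteAdeleRing (𝓞 (K i)) (K i)) * u i) *ᵥ w = (N : finAdeleQ) • (c.cmRepMatrix u *ᵥ w) := by
  have hN : (fun i => (N : FiniteAdeleRing (𝓞 (K i)) (K i)) * u i) =
      (fun i => ratFiniteAdeleTensorEquiv (K i) ((N : finAdeleQ) ⊗ₜ[ℚ] (1 : K i))) * u := by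
    funext i
    rw [Pi.mul_apply, ratFiniteAdeleTensorEquiv_tmul, map_one, one_mul, map_natCast]
  rw [hN, c.cmRepMatrix_mul, c.cmRepMatrix_baseChange_scalar, ← Matrix.mulVec_mulVec, Matrix.smul_mulVec,
    Matrix.one_mulVec]

/-! ### §2. The rational lattice `∏ 𝔞ᵢ` forces the adelic lattice `∏ 𝔞̂ᵢ` -/

/-- **`q_v⁻¹(Λ_a) = ∏ 𝔞ᵢ` RATIONALLY ⇒ `Θ_v⁻¹(a·ẑ^{2g}) = ∏ 𝔞̂ᵢ` ADELICALLY**, granted the boundedness `hbdd` of the orbit map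
`Θ_v : u ↦ R(u)·(v ⊗ 1)` on the integral adèles `∏ᵢ 𝓞̂ᵢ`.  Proof: with `M := N·N_a` (`N` from `hbdd`, `N_a` a common denominator of
`a⁻¹`, ★ `exists_nat_mul_entries_mem`) and `Dᵢ ∈ 𝓞_{Kᵢ}` a denominator of `𝔞ᵢ` (`Dᵢ𝔞ᵢ ⊆ 𝓞`), strong approximation
(★ `exists_sub_algebraMap_mem_idealAdeles`) writes `u = x ⊗ 1 + u′` with `x ∈ F` and `u′ᵢ ∈ (M·Dᵢ·𝔞ᵢ)^ ⊆ 𝔞̂ᵢ ∩ M·𝓞̂ᵢ`; then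
`a⁻¹·Θ_v(u′) ∈ ẑ^{2g}` (the two denominators are cleared by `M`), so `a⁻¹·Θ_v(u) ∈ ẑ^{2g} ↔ a⁻¹·Θ_v(x ⊗ 1) ∈ ẑ^{2g} ↔ act(x)·v ∈ Λ_a
↔ x ∈ ∏ 𝔞ᵢ ↔ u ∈ ∏ 𝔞̂ᵢ` («`K ∩ 𝔞̂ = 𝔞`», ★ `algebraMap_mem_idealAdeles_iff`).
[cite: Shimura1998, §18.3 pp. 122–123] [cite: Milne2005ShimuraVarieties, §4 pp. 48–49] [cite: CasselsFrohlichANT1967, Ch. II §15] -/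
theorem forall_inv_mulVec_mem_iff_of_rational {v : Fin g ⊕ Fin g → ℚ} {a : GL (Fin g ⊕ Fin g) finAdeleQ}
    {𝔞 : Π i, FractionalIdeal (𝓞 (K i))⁰ (K i)} (h𝔞 : ∀ i, 𝔞 i ≠ 0)
    (hrat : ∀ x : Π i, K i, c.act x v ∈ latticeOfGL a ↔ ∀ i, x i ∈ 𝔞 i)
    (hbdd : ∃ N : ℕ, N ≠ 0 ∧ ∀ u : Π i, FiniteAdeleRing (𝓞 (K i)) (K i),
      (∀ i, u i ∈ idealAdeles (1 : FractionalIdeal (𝓞 (K i))⁰ (K i))) →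
        ∀ j, (N : finAdeleQ) * (c.cmRepMatrix u *ᵥ fun j => algebraMap ℚ finAdeleQ (v j)) j ∈ integralFiniteAdeles ℚ)
    (u : Π i, FiniteAdeleRing (𝓞 (K i)) (K i)) :
    (∀ j, (((a⁻¹ : GL (Fin g ⊕ Fin g) finAdeleQ) : Matrix (Fin g ⊕ Fin g) (Fin g ⊕ Fin g) finAdeleQ) *ᵥ
          (c.cmRepMatrix u *ᵥ fun j => algebraMap ℚ finAdeleQ (v j))) j ∈ integralFiniteAdeles ℚ) ↔
      ∀ i, u i ∈ idealAdeles (𝔞 i) := by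
  classical
  set w : Fin g ⊕ Fin g → finAdeleQ := fun j => algebraMap ℚ finAdeleQ (v j) with hw
  obtain ⟨N, hN, hbd⟩ := hbdd
  obtain ⟨Na, hNa, -, hainv⟩ := exists_nat_mul_entries_mem a
  -- denominators of the `𝔞ᵢ`
  have hD : ∀ i, ∃ D : 𝓞 (K i), D ≠ 0 ∧ ∀ b ∈ 𝔞 i, (algebraMap (𝓞 (K i)) (K i) D) * b ∈ (1 : FractionalIdeal (𝓞 (K i))⁰ (K i)) := by
    intro i
    obtain ⟨D, hDS, hDint⟩ := (𝔞 i).isFractional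
    refine ⟨D, nonZeroDivisors.ne_zero hDS, fun b hb => ?_⟩
    obtain ⟨y, hy⟩ := hDint b hb
    rw [FractionalIdeal.mem_one_iff]
    exact ⟨y, by rw [hy, Algebra.smul_def]⟩
  choose D hD0 hDint using hD
  -- the modulus `𝔟ᵢ = (M·Dᵢ)·𝔞ᵢ`, `M = N·Na`
  set M : ℕ := N * Na with hM
  have hM0 : M ≠ 0 := mul_ne_zero hN hNa
  have hMK : ∀ i, ((M : ℕ) : K i) ≠ 0 := fun i => Nat.cast_ne_zero.2 hM0
  set 𝔟 : Π i, FractionalIdeal (𝓞 (K i))⁰ (K i) :=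
    fun i => FractionalIdeal.spanSingleton (𝓞 (K i))⁰ ((M : K i) * algebraMap (𝓞 (K i)) (K i) (D i)) * 𝔞 i with h𝔟
  have h𝔟0 : ∀ i, 𝔟 i ≠ 0 := fun i =>
    mul_ne_zero (FractionalIdeal.spanSingleton_ne_zero_iff.2
      (mul_ne_zero (hMK i) ((map_ne_zero_iff _ (FaithfulSMul.algebraMap_injective (𝓞 (K i)) (K i))).2 (hD0 i)))) (h𝔞 i)
  -- `𝔟ᵢ ≤ 𝔞ᵢ`
  have h𝔟le : ∀ i, 𝔟 i ≤ 𝔞 i := by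
    intro i
    rw [h𝔟]
    refine FractionalIdeal.spanSingleton_mul_le_iff.2 fun z hz => ?_
    have h1 : ((M : K i) * algebraMap (𝓞 (K i)) (K i) (D i)) * z =
        (algebraMap (𝓞 (K i)) (K i) ((M : 𝓞 (K i)) * D i)) • z := by
      rw [map_mul, map_natCast, smul_eq_mul]
    rw [h1]
    exact Submodule.smul_mem _ _ hz
  -- `𝔟ᵢ ≤ (M)`: `M·Dᵢ·𝔞ᵢ ⊆ M·𝓞`
  have h𝔟leM : ∀ i, 𝔟 i ≤ FractionalIdeal.spanSingleton (𝓞 (K i))⁰ (M : K i) := by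
    intro i
    rw [h𝔟]
    refine FractionalIdeal.spanSingleton_mul_le_iff.2 fun z hz => ?_
    rw [mul_assoc, FractionalIdeal.mem_spanSingleton]
    obtain ⟨y, hy⟩ := (FractionalIdeal.mem_one_iff _).1 (hDint i z hz)
    exact ⟨y, by rw [Algebra.smul_def, hy, mul_comm]⟩
  -- strong approximation modulo `𝔟ᵢ`: `u = x ⊗ 1 + u′`
  have happrox : ∀ i, ∃ x : K i, u i - algebraMap (K i) (FiniteAdeleRing (𝓞 (K i)) (K i)) x ∈ idealAdeles (𝔟 i) :=
    fun i => exists_sub_algebraMap_mem_idealAdeles (h𝔟0 i) (u i)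
  choose x hx using happrox
  set u' : Π i, FiniteAdeleRing (𝓞 (K i)) (K i) :=
    fun i => u i - algebraMap (K i) (FiniteAdeleRing (𝓞 (K i)) (K i)) (x i) with hu'
  have hu'𝔞 : ∀ i, u' i ∈ idealAdeles (𝔞 i) := fun i => idealAdeles_mono (h𝔟0 i) (h𝔟le i) (hx i)
  -- `u′ᵢ = M · u″ᵢ` with `u″ᵢ ∈ 𝓞̂ᵢ`
  set Mu : Π i, (FiniteAdeleRing (𝓞 (K i)) (K i))ˣ :=
    fun i => FiniteAdeleRing.unitEmbedding (𝓞 (K i)) (K i) (Units.mk0 (M : K i) (hMK i)) with hMu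
  have hMu_coe : ∀ i, ((Mu i : (FiniteAdeleRing (𝓞 (K i)) (K i))ˣ) : FiniteAdeleRing (𝓞 (K i)) (K i)) =
      (M : FiniteAdeleRing (𝓞 (K i)) (K i)) := by
    intro i
    rw [hMu, FiniteAdeleRing.unitEmbedding_apply, Units.val_mk0, map_natCast]
  set u'' : Π i, FiniteAdeleRing (𝓞 (K i)) (K i) :=
    fun i => (((Mu i)⁻¹ : (FiniteAdeleRing (𝓞 (K i)) (K i))ˣ) : FiniteAdeleRing (𝓞 (K i)) (K i)) * u' i with hu''
  have hu''int : ∀ i, u'' i ∈ idealAdeles (1 : FractionalIdeal (𝓞 (K i))⁰ (K i)) := by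
    intro i
    have hmem : u' i ∈ idealAdeles (toFractionalIdeal (𝓞 (K i)) (K i) (Mu i) * 1) := by
      rw [mul_one, hMu, toFractionalIdeal_unitEmbedding, Units.val_mk0]
      exact idealAdeles_mono (h𝔟0 i) (h𝔟leM i) (hx i)
    have h2 : (Mu i : FiniteAdeleRing (𝓞 (K i)) (K i)) * u'' i = u' i := by
      rw [hu'', ← mul_assoc, Units.mul_inv, one_mul]
    rw [← h2] at hmem
    exact (mul_mem_idealAdeles_iff (Mu i) one_ne_zero).1 hmem
  have hu'eq : u' = fun i => (M : FiniteAdeleRing (𝓞 (K i)) (K i)) * u'' i := by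
    funext i
    rw [hu'', ← mul_assoc, ← hMu_coe i, Units.mul_inv, one_mul]
  -- decomposition of `u` and of `Θ_v(u)`
  have hux : u = (fun i => algebraMap (K i) (FiniteAdeleRing (𝓞 (K i)) (K i)) (x i)) + u' := by
    funext i
    rw [Pi.add_apply, hu', add_sub_cancel]
  have hΘu : c.cmRepMatrix u *ᵥ w = (⇑(algebraMap ℚ finAdeleQ) ∘ c.act x v) + (M : finAdeleQ) • (c.cmRepMatrix u'' *ᵥ w) := by
    rw [hux, c.cmRepMatrix_add, Matrix.add_mulVec, c.cmRepMatrix_algebraMap_mulVec_algebraMap, hu'eq,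
      c.cmRepMatrix_natCast_mul_mulVec]
  -- `a⁻¹ · Θ_v(u′) ∈ ẑ^{2g}`
  have hint' : ∀ j, ((((a⁻¹ : GL (Fin g ⊕ Fin g) finAdeleQ) : Matrix (Fin g ⊕ Fin g) (Fin g ⊕ Fin g) finAdeleQ)) *ᵥ
      ((M : finAdeleQ) • (c.cmRepMatrix u'' *ᵥ w))) j ∈ integralFiniteAdeles ℚ := by
    intro j
    rw [Matrix.mulVec_smul, Pi.smul_apply, smul_eq_mul, hM, Nat.cast_mul, Matrix.mulVec, dotProduct, Finset.mul_sum]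
    refine sum_mem fun k _ => ?_
    have hk := hbd u'' hu''int k
    have : (N : finAdeleQ) * (Na : finAdeleQ) *
        ((((a⁻¹ : GL (Fin g ⊕ Fin g) finAdeleQ) : Matrix (Fin g ⊕ Fin g) (Fin g ⊕ Fin g) finAdeleQ)) j k *
          (c.cmRepMatrix u'' *ᵥ w) k) =
        ((Na : finAdeleQ) * (((a⁻¹ : GL (Fin g ⊕ Fin g) finAdeleQ) : Matrix (Fin g ⊕ Fin g) (Fin g ⊕ Fin g) finAdeleQ)) j k) *
          ((N : finAdeleQ) * (c.cmRepMatrix u'' *ᵥ w) k) := by ring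
    rw [this]
    exact mul_mem (hainv j k) hk
  -- the equivalence
  have hsplit : ∀ j, ((((a⁻¹ : GL (Fin g ⊕ Fin g) finAdeleQ) : Matrix (Fin g ⊕ Fin g) (Fin g ⊕ Fin g) finAdeleQ)) *ᵥ
        (c.cmRepMatrix u *ᵥ w)) j =
      ((((a⁻¹ : GL (Fin g ⊕ Fin g) finAdeleQ) : Matrix (Fin g ⊕ Fin g) (Fin g ⊕ Fin g) finAdeleQ)) *ᵥ
          (⇑(algebraMap ℚ finAdeleQ) ∘ c.act x v)) j +
        ((((a⁻¹ : GL (Fin g ⊕ Fin g) finAdeleQ) : Matrix (Fin g ⊕ Fin g) (Fin g ⊕ Fin g) finAdeleQ)) *ᵥ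
          ((M : finAdeleQ) • (c.cmRepMatrix u'' *ᵥ w))) j := by
    intro j
    rw [hΘu, Matrix.mulVec_add, Pi.add_apply]
  have hxmem : c.act x v ∈ latticeOfGL a ↔ ∀ i, u i ∈ idealAdeles (𝔞 i) := by
    rw [hrat]
    refine forall_congr' fun i => ?_
    rw [← algebraMap_mem_idealAdeles_iff (h𝔞 i)]
    have hi : u i = algebraMap (K i) (FiniteAdeleRing (𝓞 (K i)) (K i)) (x i) + u' i := by
      rw [hu', add_sub_cancel]
    constructor
    · intro h
      rw [hi]
      exact add_mem h (hu'𝔞 i)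
    · intro h
      have : algebraMap (K i) (FiniteAdeleRing (𝓞 (K i)) (K i)) (x i) = u i - u' i := by rw [hi, add_sub_cancel_right]
      rw [this]
      exact sub_mem h (hu'𝔞 i)
  rw [← hxmem, mem_latticeOfGL_iff]
  constructor
  · intro h j
    have hj := sub_mem (h j) (hint' j)
    rwa [hsplit j, add_sub_cancel_right] at hj
  · intro h j
    rw [hsplit j]
    exact add_mem (h j) (hint' j)

/-! ### §3. Corollary: the translated lattice from the rational reading -/

/-- **From the RATIONAL reading of `[J, a]` to the lattice of `[J, r·a]`**: if `q_v⁻¹(Λ_a) = ∏ 𝔞ᵢ` (rationally), `Θ_v` is bounded on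
integral adèles (`hbdd`) and `(r : matrix) = R(t)`, then `act(x)·v ∈ Λ_{r·a} ↔ xᵢ ∈ tᵢ𝔞ᵢ` (★ R60-35 `act_mem_latticeOfGL_mul_iff`
with its adelic hypothesis discharged by §2). [cite: Shimura1998, §18.3 pp. 122–123] [cite: Milne2005ShimuraVarieties, Def. 12.8 (60)–(62) p. 114] -/
theorem act_mem_latticeOfGL_mul_iff_of_rational {v : Fin g ⊕ Fin g → ℚ} {a r : GL (Fin g ⊕ Fin g) finAdeleQ}
    {t : Π i, (FiniteAdeleRing (𝓞 (K i)) (K i))ˣ}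
    (hr : ((r : GL (Fin g ⊕ Fin g) finAdeleQ) : Matrix (Fin g ⊕ Fin g) (Fin g ⊕ Fin g) finAdeleQ) =
      c.cmRepMatrix fun i => (t i : FiniteAdeleRing (𝓞 (K i)) (K i)))
    {𝔞 : Π i, FractionalIdeal (𝓞 (K i))⁰ (K i)} (h𝔞 : ∀ i, 𝔞 i ≠ 0)
    (hrat : ∀ x : Π i, K i, c.act x v ∈ latticeOfGL a ↔ ∀ i, x i ∈ 𝔞 i)
    (hbdd : ∃ N : ℕ, N ≠ 0 ∧ ∀ u : Π i, FiniteAdeleRing (𝓞 (K i)) (K i),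
      (∀ i, u i ∈ idealAdeles (1 : FractionalIdeal (𝓞 (K i))⁰ (K i))) →
        ∀ j, (N : finAdeleQ) * (c.cmRepMatrix u *ᵥ fun j => algebraMap ℚ finAdeleQ (v j)) j ∈ integralFiniteAdeles ℚ)
    (x : Π i, K i) :
    c.act x v ∈ latticeOfGL (r * a) ↔ ∀ i, x i ∈ ideleMulIdeal (t i) (𝔞 i) :=
  c.act_mem_latticeOfGL_mul_iff hr h𝔞 (c.forall_inv_mulVec_mem_iff_of_rational h𝔞 hrat hbdd) x

/-- The same at the reciprocity element `r(s)` (`(r : matrix) = c.cmRecipMatrix Φ E s`, the binder of ★ `IsCanonical`): from the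
rational reading of `[J, a]`, the lattice of `[J, r(s)·a]` is `∏ N_{E,Φᵢ}(s)·𝔞ᵢ` (Milne's normalisation).
[cite: Milne2005ShimuraVarieties, Thm. 11.2 p. 108; Def. 12.8 (60)–(62) p. 114] [cite: Shimura1998, §18.3 pp. 122–123] -/
theorem act_mem_latticeOfGL_mul_iff_of_rational_of_coe_eq_cmRecipMatrix {v : Fin g ⊕ Fin g → ℚ}
    {a r : GL (Fin g ⊕ Fin g) finAdeleQ} (Φ : ∀ i, CMType (K i)) (E : IntermediateField ℚ ℂ) [NumberField ↥E]
    (s : (FiniteAdeleRing (𝓞 ↥E) ↥E)ˣ)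
    (hr : ((r : GL (Fin g ⊕ Fin g) finAdeleQ) : Matrix (Fin g ⊕ Fin g) (Fin g ⊕ Fin g) finAdeleQ) = c.cmRecipMatrix Φ E s)
    {𝔞 : Π i, FractionalIdeal (𝓞 (K i))⁰ (K i)} (h𝔞 : ∀ i, 𝔞 i ≠ 0)
    (hrat : ∀ x : Π i, K i, c.act x v ∈ latticeOfGL a ↔ ∀ i, x i ∈ 𝔞 i)
    (hbdd : ∃ N : ℕ, N ≠ 0 ∧ ∀ u : Π i, FiniteAdeleRing (𝓞 (K i)) (K i),
      (∀ i, u i ∈ idealAdeles (1 : FractionalIdeal (𝓞 (K i))⁰ (K i))) →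
        ∀ j, (N : finAdeleQ) * (c.cmRepMatrix u *ᵥ fun j => algebraMap ℚ finAdeleQ (v j)) j ∈ integralFiniteAdeles ℚ)
    (x : Π i, K i) :
    c.act x v ∈ latticeOfGL (r * a) ↔ ∀ i, x i ∈ ideleMulIdeal (reflexNormFiniteIdele (K i) (Φ i) E s) (𝔞 i) :=
  c.act_mem_latticeOfGL_mul_iff_of_rational (t := fun i => reflexNormFiniteIdele (K i) (Φ i) E s) hr h𝔞 hrat hbdd x

end CMStructure

end Literature.AlgebraicGeometry.ModuliOfAbelianVarieties

end
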